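import Literature.NumberTheory.Rogawski1990.TamagawaSingularMembersFinTFCovol   -- ★ p844690: the letters' FRAME and κ-block vocabulary (`CanonicalTransferMatrix`, `ArchCanonicalSingularMatrix`, …)
import Literature.NumberTheory.Weil1982.UnitaryFinCentralizerTopFormHaar         -- ★ p850468 `UnitaryFinTopForm.finTamagawaPartner` (|ω|_v-Tamagawa partners, X2♮'s (Q^ω))
import Literature.NumberTheory.Rogawski1990.FinExplicitTransferFactorConjLeft     -- ★ `finExplicitDelta_conj_left_all`  (explicit collection `Δ‴`, H-side conjugation invariance)
import Literature.NumberTheory.Rogawski1990.FinExplicitTransferFactorConjRight    -- ★ `finExplicitDelta_conj_right_all` (G-side)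
import Literature.NumberTheory.Rogawski1990.ArchCanonicalTransferFactor           -- ★ `archCanonicalTransferFactor` = `Δ‴_∞ = c(H′)·Δ″_∞`
import Literature.NumberTheory.Rogawski1990.ExplicitFactorProductFormula          -- ★ `satisfiesProductFormula_finExplicitCollection` + the three reciprocity laws; `UnitaryGroup.PlacesOver` idiom
import Literature.NumberTheory.Automorphic.QuadraticHeckeCharacterCM              -- ★ `quadraticHeckeCharCM` = `ω_{L∕L⁺}` (the μ-GUARD of print's endoscopic datum, as in the P3a line)
import Literature.NumberTheory.Rogawski1990.AdelicStableOrbitalEulerDischargeSemisimple  -- ★ `mul_sub_smul_toLocal_toAdelic_eq_zero`, `isUnit_algebraMap_localRing_sub` (the κ-block relation at `v`)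
import Summits.HodgeConjecture.HodgeConjecture.Theorems.K2E4SingularTransferKernelCore      -- ★ p854879 (this seat): `singularTransfer_of_kernel_of_charge` — kernel ⊆ + charged pair ⇒ (κ-loc), c_v ≠ 0
import HarnessLib

/-!
# K2 · E4 socket #3 `ExplicitNonsplitSingularTransfer` — the GERM ROUTE on the LIVE U3 sockets of EDITION 3: ‹#5› → ‹#7R› → ‹#3›

`Summits/HodgeConjecture/HodgeConjecture/Theorems/K2E4ExplicitNonsplitSingularTransferR.lean` (HCML Track B «K2-LIT», chair K2-lead, dealer K2E4-plan; seat K2E4-p03,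
follow-on (B) to ★ `Theorems/K2E4ExplicitNonsplitSingularTransfer` p854803).  Chair RULING R11 (21:19:25Z): the un-pinned charge socket #7 `sig_K2E3GermConstantRegularH` is
underivable for WEAK data at `v ∈ Sbad` and is replaced, for the junction reductions, by its R-TWIN #7R `sig_K2E3GermConstantRegularHR` of `…SigsFinGermConstants.lean` EDITION 3
(sha16 0b7360e1bac8109c, :309–359: the same conclusion under the five PINNED-DATA binders `μ`, `hμu`, `hμω`, `hΔ`, `hTinf`).  ★ p854803 consumed #7; THIS file re-issues the
reduction on the LIVE sockets: hypotheses = #5 `sig_K2E3GermConstantStableSheets` (:119–177) and #7R (:310–359) VERBATIM, conclusion = socket #3 `sig_K2E4ExplicitNonsplitSingularTransfer`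
of `…SigsFinSingularTransferExplicit.lean` (sha16 0b8f110a305a6096, :117–176) VERBATIM — all under the letters' 49-binder frame.  Since #3 itself carries `μ … hTinf`, #7R feeds
without loss.  The proof is three moves: read the frame's side conditions (`det H′ ≠ 0`; `m_H`, `m_G` admissible from `hCTM`'s `IsLocalTransferDatum`; the κ-block relation
`(γ_{0,v} − e₁)(γ_{0,v} − e₂) = 0` with `e₁ − e₂` a unit; the members of the Weil-form family `mGs₀ v` along `𝒪_st(γ_{0,v})` are quotient measures, hence Radon), then apply the
frame-light core ★ `K2E4SingularTransferKernelCore.singularTransfer_of_kernel_of_charge` to the two sockets read at these data.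
[Rogawski1990 Prop. 8.2.1 (a) p. 118: «Then `Δ_{G/H}(γ₀)Φ^κ(γ₀, f) = f^H(γ₀)`»; Prop. 8.1.3 p. 116; (8.1.1)–(8.1.2) p. 117.]

HONEST LABEL: HC_CM is proved only modulo the 7 printed citations (2 remaining named inputs: hLiu418 = stmt-HodgeConjecture-24832, h413 = stmt-HodgeConjecture-24833)
until rung 0 closes.  Sorry-free, axiom-clean; it proves the IMPLICATION between frozen socket statements — the germ kernel (#5) and the charge (#7R) are E3's to pay
(`Theorems/K2E3GermConstantStableSheets`, `Theorems/K2E3GermConstantRegularHR`); then `ExplicitNonsplitSingularTransfer : ‹#3›` is their one-line application.  No `def`, no instance, no notation.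

## References
* [Rogawski1990] J. D. Rogawski, *Automorphic Representations of Unitary Groups in Three Variables*, Ann. of Math. Stud. 123 (1990): §8.1 Prop. 8.1.3 p. 116, (8.1.1)–(8.1.2) p. 117;
  §8.2 Prop. 8.2.1 (a) p. 118; §4.3 (4.3.1) p. 43; §4.9 (4.9.1) p. 55.
-/

set_option autoImplicit false
set_option linter.dupNamespace false

noncomputable section

open MeasureTheory Measure NumberField IsDedekindDomain
open Literature.MeasureTheory.Group Literature.MeasureTheory.RestrictedProduct
open Literature.Topology.RestrictedProduct Literature.Topology.Algebra.RestrictedProduct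
open Literature.NumberTheory.Rogawski1990 Literature.NumberTheory.Automorphic
open Literature.AlgebraicGeometry.ShimuraVarieties (unitaryGroup hermForm)
open scoped Matrix MatrixGroups RestrictedProduct

namespace Summit.HodgeConjecture.HodgeConjecture.Cruxes.H413.K2E4ExplicitNonsplitSingularTransferR

/-- `H′` anisotropic ⇒ `det H′ ≠ 0` (a kernel vector is isotropic). [cite: Rogawski1990, §3.8 p. 30] -/
private theorem det_ne_zero_of_anisotropic {L : Type} [Field L] [NumberField L] [IsCMField L] {H' : Matrix (Fin 3) (Fin 3) L}
    (hanis : ∀ x : Fin 3 → L, hermForm (cmConjRingHom L) H' x x = 0 → x = 0) : H'.det ≠ 0 := by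
  intro hdet
  obtain ⟨x, hx, hHx⟩ := Matrix.exists_mulVec_eq_zero_iff.mpr hdet
  refine hx (hanis x ?_)
  rw [hermForm, hHx, dotProduct_zero]

/-- The characteristic polynomial `(X − e₁)²(X − e₂)` is not separable: the κ-block's `γ₀` is NOT regular. [cite: Rogawski1990, §3.1 p. 19] -/
private theorem not_isRegularElt_of_charpoly {R : Type*} [Field R] (g : GL (Fin 3) R) (e₁ e₂ : R)
    (hchar : (g : Matrix (Fin 3) (Fin 3) R).charpoly = (Polynomial.X - Polynomial.C e₁) ^ 2 * (Polynomial.X - Polynomial.C e₂)) :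
    ¬ IsRegularElt g := by
  intro hreg
  rw [isRegularElt_iff, hchar] at hreg
  have h2 := (Polynomial.Separable.of_pow (Polynomial.not_isUnit_X_sub_C e₁) two_ne_zero hreg.of_mul_left).2
  exact absurd h2 (by norm_num)

section Frame

variable (L : Type) [Field L] [NumberField L] [IsCMField L]

variable (H' : Matrix (Fin 3) (Fin 3) L) (Tinf : ArchTransferFactor L H')
    -- σ-algebras of the `G′` side (★ (O10-c5) block), of `H_v`, `G_∞`, `H_∞`, and the Haar data — EXACTLY ★ `SingularEllipticTransfer`'s binders
    [∀ g : (UnitaryGroup.cmDatum L 3 H').Adelic, MeasurableSpace ((UnitaryGroup.cmDatum L 3 H').Adelic ⧸ Subgroup.centralizer ({g} : Set (UnitaryGroup.cmDatum L 3 H').Adelic))]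
    [∀ g : (UnitaryGroup.cmDatum L 3 H').Adelic, BorelSpace ((UnitaryGroup.cmDatum L 3 H').Adelic ⧸ Subgroup.centralizer ({g} : Set (UnitaryGroup.cmDatum L 3 H').Adelic))]
    [∀ γ : UnitaryGroup.arch (↥(maximalRealSubfield L)) L (IsCMField.complexConj L) 3 H',
      MeasurableSpace (UnitaryGroup.arch (↥(maximalRealSubfield L)) L (IsCMField.complexConj L) 3 H' ⧸ Subgroup.centralizer ({γ} : Set (UnitaryGroup.arch (↥(maximalRealSubfield L)) L (IsCMField.complexConj L) 3 H')))]
    [∀ γ : UnitaryGroup.arch (↥(maximalRealSubfield L)) L (IsCMField.complexConj L) 3 H',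
      BorelSpace (UnitaryGroup.arch (↥(maximalRealSubfield L)) L (IsCMField.complexConj L) 3 H' ⧸ Subgroup.centralizer ({γ} : Set (UnitaryGroup.arch (↥(maximalRealSubfield L)) L (IsCMField.complexConj L) 3 H')))]
    [∀ (v : HeightOneSpectrum (𝓞 ↥(maximalRealSubfield L))) (γ : (UnitaryGroup.cmDatum L 3 H').Local v),
      MeasurableSpace ((UnitaryGroup.cmDatum L 3 H').Local v ⧸ Subgroup.centralizer ({γ} : Set ((UnitaryGroup.cmDatum L 3 H').Local v)))]
    [∀ (v : HeightOneSpectrum (𝓞 ↥(maximalRealSubfield L))) (γ : (UnitaryGroup.cmDatum L 3 H').Local v),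
      BorelSpace ((UnitaryGroup.cmDatum L 3 H').Local v ⧸ Subgroup.centralizer ({γ} : Set ((UnitaryGroup.cmDatum L 3 H').Local v)))]
    [∀ v : HeightOneSpectrum (𝓞 ↥(maximalRealSubfield L)), MeasurableSpace ((UnitaryGroup.cmDatum L 3 H').Local v)] [∀ v : HeightOneSpectrum (𝓞 ↥(maximalRealSubfield L)), BorelSpace ((UnitaryGroup.cmDatum L 3 H').Local v)]
    [MeasurableSpace (UnitaryGroup.cmDatum L 3 H').Adelic] [BorelSpace (UnitaryGroup.cmDatum L 3 H').Adelic]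
    [MeasurableSpace (UnitaryGroup.arch (↥(maximalRealSubfield L)) L (IsCMField.complexConj L) 3 H')] [BorelSpace (UnitaryGroup.arch (↥(maximalRealSubfield L)) L (IsCMField.complexConj L) 3 H')]
    [∀ γ : (UnitaryGroup.cmDatum L 3 H').Adelic, MeasurableSpace (↥(Subgroup.centralizer ({γ} : Set (UnitaryGroup.cmDatum L 3 H').Adelic)) ⧸
      ((UnitaryGroup.cmDatum L 3 H').quotientSubgroup ⊓ Subgroup.centralizer ({γ} : Set (UnitaryGroup.cmDatum L 3 H').Adelic)).subgroupOf (Subgroup.centralizer ({γ} : Set (UnitaryGroup.cmDatum L 3 H').Adelic)))]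
    [∀ γ : (UnitaryGroup.cmDatum L 3 H').Adelic, BorelSpace (↥(Subgroup.centralizer ({γ} : Set (UnitaryGroup.cmDatum L 3 H').Adelic)) ⧸
      ((UnitaryGroup.cmDatum L 3 H').quotientSubgroup ⊓ Subgroup.centralizer ({γ} : Set (UnitaryGroup.cmDatum L 3 H').Adelic)).subgroupOf (Subgroup.centralizer ({γ} : Set (UnitaryGroup.cmDatum L 3 H').Adelic)))]
    [hCcl : ∀ γ : (UnitaryGroup.cmDatum L 3 H').Adelic, IsClosed ((Subgroup.centralizer ({γ} : Set (UnitaryGroup.cmDatum L 3 H').Adelic) : Subgroup (UnitaryGroup.cmDatum L 3 H').Adelic) : Set (UnitaryGroup.cmDatum L 3 H').Adelic)]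
    [∀ γ : (UnitaryGroup.cmDatum L 3 H').Adelic, (count : Measure ↥(((UnitaryGroup.cmDatum L 3 H').quotientSubgroup ⊓ Subgroup.centralizer ({γ} : Set (UnitaryGroup.cmDatum L 3 H').Adelic)).subgroupOf
      (Subgroup.centralizer ({γ} : Set (UnitaryGroup.cmDatum L 3 H').Adelic)))).IsHaarMeasure]
    [∀ v : HeightOneSpectrum (𝓞 ↥(maximalRealSubfield L)), MeasurableSpace ((UnitaryGroup.cmDatum L 2 (Matrix.of fun i j : Fin 2 => if i.val + j.val + 1 = 2 then (1 : L) else 0)).Local v ×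
        (UnitaryGroup.cmDatum L 1 (Matrix.of fun i j : Fin 1 => if i.val + j.val + 1 = 1 then (1 : L) else 0)).Local v)]
    [∀ v : HeightOneSpectrum (𝓞 ↥(maximalRealSubfield L)), BorelSpace ((UnitaryGroup.cmDatum L 2 (Matrix.of fun i j : Fin 2 => if i.val + j.val + 1 = 2 then (1 : L) else 0)).Local v ×
        (UnitaryGroup.cmDatum L 1 (Matrix.of fun i j : Fin 1 => if i.val + j.val + 1 = 1 then (1 : L) else 0)).Local v)]
    [∀ (v : HeightOneSpectrum (𝓞 ↥(maximalRealSubfield L))) (a : ((UnitaryGroup.cmDatum L 2 (Matrix.of fun i j : Fin 2 => if i.val + j.val + 1 = 2 then (1 : L) else 0)).Local v ×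
        (UnitaryGroup.cmDatum L 1 (Matrix.of fun i j : Fin 1 => if i.val + j.val + 1 = 1 then (1 : L) else 0)).Local v)),
      MeasurableSpace (((UnitaryGroup.cmDatum L 2 (Matrix.of fun i j : Fin 2 => if i.val + j.val + 1 = 2 then (1 : L) else 0)).Local v ×
        (UnitaryGroup.cmDatum L 1 (Matrix.of fun i j : Fin 1 => if i.val + j.val + 1 = 1 then (1 : L) else 0)).Local v) ⧸ Subgroup.centralizer ({a} : Set ((UnitaryGroup.cmDatum L 2 (Matrix.of fun i j : Fin 2 => if i.val + j.val + 1 = 2 then (1 : L) else 0)).Local v ×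
        (UnitaryGroup.cmDatum L 1 (Matrix.of fun i j : Fin 1 => if i.val + j.val + 1 = 1 then (1 : L) else 0)).Local v)))]
    [∀ (v : HeightOneSpectrum (𝓞 ↥(maximalRealSubfield L))) (a : ((UnitaryGroup.cmDatum L 2 (Matrix.of fun i j : Fin 2 => if i.val + j.val + 1 = 2 then (1 : L) else 0)).Local v ×
        (UnitaryGroup.cmDatum L 1 (Matrix.of fun i j : Fin 1 => if i.val + j.val + 1 = 1 then (1 : L) else 0)).Local v)),
      BorelSpace (((UnitaryGroup.cmDatum L 2 (Matrix.of fun i j : Fin 2 => if i.val + j.val + 1 = 2 then (1 : L) else 0)).Local v ×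
        (UnitaryGroup.cmDatum L 1 (Matrix.of fun i j : Fin 1 => if i.val + j.val + 1 = 1 then (1 : L) else 0)).Local v) ⧸ Subgroup.centralizer ({a} : Set ((UnitaryGroup.cmDatum L 2 (Matrix.of fun i j : Fin 2 => if i.val + j.val + 1 = 2 then (1 : L) else 0)).Local v ×
        (UnitaryGroup.cmDatum L 1 (Matrix.of fun i j : Fin 1 => if i.val + j.val + 1 = 1 then (1 : L) else 0)).Local v)))]
    [MeasurableSpace (UnitaryGroup.arch (↥(maximalRealSubfield L)) L (IsCMField.complexConj L) 3 (Matrix.of fun i j : Fin 3 => if i.val + j.val + 1 = 3 then (1 : L) else 0))] [BorelSpace (UnitaryGroup.arch (↥(maximalRealSubfield L)) L (IsCMField.complexConj L) 3 (Matrix.of fun i j : Fin 3 => if i.val + j.val + 1 = 3 then (1 : L) else 0))]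
    [∀ γ : UnitaryGroup.arch (↥(maximalRealSubfield L)) L (IsCMField.complexConj L) 3 (Matrix.of fun i j : Fin 3 => if i.val + j.val + 1 = 3 then (1 : L) else 0),
      MeasurableSpace (UnitaryGroup.arch (↥(maximalRealSubfield L)) L (IsCMField.complexConj L) 3 (Matrix.of fun i j : Fin 3 => if i.val + j.val + 1 = 3 then (1 : L) else 0) ⧸ Subgroup.centralizer ({γ} : Set (UnitaryGroup.arch (↥(maximalRealSubfield L)) L (IsCMField.complexConj L) 3 (Matrix.of fun i j : Fin 3 => if i.val + j.val + 1 = 3 then (1 : L) else 0))))]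
    [∀ γ : UnitaryGroup.arch (↥(maximalRealSubfield L)) L (IsCMField.complexConj L) 3 (Matrix.of fun i j : Fin 3 => if i.val + j.val + 1 = 3 then (1 : L) else 0),
      BorelSpace (UnitaryGroup.arch (↥(maximalRealSubfield L)) L (IsCMField.complexConj L) 3 (Matrix.of fun i j : Fin 3 => if i.val + j.val + 1 = 3 then (1 : L) else 0) ⧸ Subgroup.centralizer ({γ} : Set (UnitaryGroup.arch (↥(maximalRealSubfield L)) L (IsCMField.complexConj L) 3 (Matrix.of fun i j : Fin 3 => if i.val + j.val + 1 = 3 then (1 : L) else 0))))]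
    [MeasurableSpace (UnitaryGroup.arch (↥(maximalRealSubfield L)) L (IsCMField.complexConj L) 2 (Matrix.of fun i j : Fin 2 => if i.val + j.val + 1 = 2 then (1 : L) else 0) ×
          UnitaryGroup.arch (↥(maximalRealSubfield L)) L (IsCMField.complexConj L) 1 (Matrix.of fun i j : Fin 1 => if i.val + j.val + 1 = 1 then (1 : L) else 0))]
    [BorelSpace (UnitaryGroup.arch (↥(maximalRealSubfield L)) L (IsCMField.complexConj L) 2 (Matrix.of fun i j : Fin 2 => if i.val + j.val + 1 = 2 then (1 : L) else 0) ×
          UnitaryGroup.arch (↥(maximalRealSubfield L)) L (IsCMField.complexConj L) 1 (Matrix.of fun i j : Fin 1 => if i.val + j.val + 1 = 1 then (1 : L) else 0))]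
    [∀ a : (UnitaryGroup.arch (↥(maximalRealSubfield L)) L (IsCMField.complexConj L) 2 (Matrix.of fun i j : Fin 2 => if i.val + j.val + 1 = 2 then (1 : L) else 0) ×
          UnitaryGroup.arch (↥(maximalRealSubfield L)) L (IsCMField.complexConj L) 1 (Matrix.of fun i j : Fin 1 => if i.val + j.val + 1 = 1 then (1 : L) else 0)),
      MeasurableSpace ((UnitaryGroup.arch (↥(maximalRealSubfield L)) L (IsCMField.complexConj L) 2 (Matrix.of fun i j : Fin 2 => if i.val + j.val + 1 = 2 then (1 : L) else 0) ×
          UnitaryGroup.arch (↥(maximalRealSubfield L)) L (IsCMField.complexConj L) 1 (Matrix.of fun i j : Fin 1 => if i.val + j.val + 1 = 1 then (1 : L) else 0)) ⧸ Subgroup.centralizer ({a} : Set (UnitaryGroup.arch (↥(maximalRealSubfield L)) L (IsCMField.complexConj L) 2 (Matrix.of fun i j : Fin 2 => if i.val + j.val + 1 = 2 then (1 : L) else 0) ×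
          UnitaryGroup.arch (↥(maximalRealSubfield L)) L (IsCMField.complexConj L) 1 (Matrix.of fun i j : Fin 1 => if i.val + j.val + 1 = 1 then (1 : L) else 0))))]
    [∀ a : (UnitaryGroup.arch (↥(maximalRealSubfield L)) L (IsCMField.complexConj L) 2 (Matrix.of fun i j : Fin 2 => if i.val + j.val + 1 = 2 then (1 : L) else 0) ×
          UnitaryGroup.arch (↥(maximalRealSubfield L)) L (IsCMField.complexConj L) 1 (Matrix.of fun i j : Fin 1 => if i.val + j.val + 1 = 1 then (1 : L) else 0)),
      BorelSpace ((UnitaryGroup.arch (↥(maximalRealSubfield L)) L (IsCMField.complexConj L) 2 (Matrix.of fun i j : Fin 2 => if i.val + j.val + 1 = 2 then (1 : L) else 0) ×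
          UnitaryGroup.arch (↥(maximalRealSubfield L)) L (IsCMField.complexConj L) 1 (Matrix.of fun i j : Fin 1 => if i.val + j.val + 1 = 1 then (1 : L) else 0)) ⧸ Subgroup.centralizer ({a} : Set (UnitaryGroup.arch (↥(maximalRealSubfield L)) L (IsCMField.complexConj L) 2 (Matrix.of fun i j : Fin 2 => if i.val + j.val + 1 = 2 then (1 : L) else 0) ×
          UnitaryGroup.arch (↥(maximalRealSubfield L)) L (IsCMField.complexConj L) 1 (Matrix.of fun i j : Fin 1 => if i.val + j.val + 1 = 1 then (1 : L) else 0))))]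
    (νH : ∀ v : HeightOneSpectrum (𝓞 ↥(maximalRealSubfield L)), Measure ((UnitaryGroup.cmDatum L 2 (Matrix.of fun i j : Fin 2 => if i.val + j.val + 1 = 2 then (1 : L) else 0)).Local v ×
        (UnitaryGroup.cmDatum L 1 (Matrix.of fun i j : Fin 1 => if i.val + j.val + 1 = 1 then (1 : L) else 0)).Local v))
    (νG : ∀ v : HeightOneSpectrum (𝓞 ↥(maximalRealSubfield L)), Measure ((UnitaryGroup.cmDatum L 3 H').Local v))
    [∀ v, IsFiniteMeasureOnCompacts (νH v)] [∀ v, (νH v).IsMulRightInvariant]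
    [∀ v, (νG v).IsHaarMeasure] [∀ v, (νG v).IsMulRightInvariant]  -- MAIN-b's strength (F2): `νG_v` Haar
    (νGi : Measure (UnitaryGroup.arch (↥(maximalRealSubfield L)) L (IsCMField.complexConj L) 3 H')) (νqi : Measure (UnitaryGroup.arch (↥(maximalRealSubfield L)) L (IsCMField.complexConj L) 3 (Matrix.of fun i j : Fin 3 => if i.val + j.val + 1 = 3 then (1 : L) else 0)))
    (νHi : Measure (UnitaryGroup.arch (↥(maximalRealSubfield L)) L (IsCMField.complexConj L) 2 (Matrix.of fun i j : Fin 2 => if i.val + j.val + 1 = 2 then (1 : L) else 0) ×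
          UnitaryGroup.arch (↥(maximalRealSubfield L)) L (IsCMField.complexConj L) 1 (Matrix.of fun i j : Fin 1 => if i.val + j.val + 1 = 1 then (1 : L) else 0)))
    [IsFiniteMeasureOnCompacts νGi] [νGi.IsMulRightInvariant] [IsFiniteMeasureOnCompacts νqi] [νqi.IsMulRightInvariant]
    [IsFiniteMeasureOnCompacts νHi] [νHi.IsMulRightInvariant]

set_option maxHeartbeats 16000000 in
set_option synthInstance.maxHeartbeats 800000 in
/-- **Socket #3 `sig_K2E4ExplicitNonsplitSingularTransfer` BY THE GERM ROUTE ON THE LIVE EDITION-3 SOCKETS** — Prop. 8.2.1 (a) at the explicit collection `Δ‴`: from the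
germ-comparison KERNEL `‹sig_K2E3GermConstantStableSheets›` (#5) and the PINNED charged pair `‹sig_K2E3GermConstantRegularHR›` (#7R, EDITION 3 R-twin), there is `c_v ≠ 0` with
`Φ^{st}_ω(γ_{0,v}, f) = c_v · f^H(γ_{H,v})` for EVERY smooth `Δ‴_v`-transfer pair.  Hypotheses and conclusion are the socket statements VERBATIM (same frame); the proof reads the
frame's side conditions and applies the frame-light core ★ `singularTransfer_of_kernel_of_charge`. [cite: Rogawski1990, §8.2 Prop. 8.2.1 (a) p. 118; §8.1 Prop. 8.1.3 p. 116, (8.1.1)–(8.1.2) p. 117] -/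
theorem explicitNonsplitSingularTransfer_of_germConstantsR
    (hKer :
        ∀ (hK : ∀ v : HeightOneSpectrum (𝓞 ↥(maximalRealSubfield L)), νG v (UnitaryGroup.cmLocalIntegralLevel L 3 H' v : Set ((UnitaryGroup.cmDatum L 3 H').Local v)) = 1)
          (hanis : ∀ x : Fin 3 → L, hermForm (cmConjRingHom L) H' x x = 0 → x = 0)
          (Sbad : Finset (HeightOneSpectrum (𝓞 ↥(maximalRealSubfield L))))
              (Δ : ∀ v : HeightOneSpectrum (𝓞 ↥(maximalRealSubfield L)), LocalTransferFactor L H' v)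
              (mH : ∀ v : HeightOneSpectrum (𝓞 ↥(maximalRealSubfield L)),
                OrbitalMeasureFamily ((UnitaryGroup.cmDatum L 2 (Matrix.of fun i j : Fin 2 => if i.val + j.val + 1 = 2 then (1 : L) else 0)).Local v ×
                  (UnitaryGroup.cmDatum L 1 (Matrix.of fun i j : Fin 1 => if i.val + j.val + 1 = 1 then (1 : L) else 0)).Local v))
              (mG : ∀ v : HeightOneSpectrum (𝓞 ↥(maximalRealSubfield L)), OrbitalMeasureFamily ((UnitaryGroup.cmDatum L 3 H').Local v))
          (m' : OrbitalMeasureFamily (UnitaryGroup.arch (↥(maximalRealSubfield L)) L (IsCMField.complexConj L) 3 H'))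
                (m : OrbitalMeasureFamily (UnitaryGroup.arch (↥(maximalRealSubfield L)) L (IsCMField.complexConj L) 3
                  (Matrix.of fun i j : Fin 3 => if i.val + j.val + 1 = 3 then (1 : L) else 0)))
                (mHi : OrbitalMeasureFamily (UnitaryGroup.arch (↥(maximalRealSubfield L)) L (IsCMField.complexConj L) 2
                    (Matrix.of fun i j : Fin 2 => if i.val + j.val + 1 = 2 then (1 : L) else 0) ×
                  UnitaryGroup.arch (↥(maximalRealSubfield L)) L (IsCMField.complexConj L) 1
                    (Matrix.of fun i j : Fin 1 => if i.val + j.val + 1 = 1 then (1 : L) else 0)))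
                (t' : ∀ γ' : UnitaryGroup.arch (↥(maximalRealSubfield L)) L (IsCMField.complexConj L) 3 H',
                  Measure (Subgroup.centralizer ({γ'} : Set (UnitaryGroup.arch (↥(maximalRealSubfield L)) L (IsCMField.complexConj L) 3 H'))))
                (t : ∀ γ : UnitaryGroup.arch (↥(maximalRealSubfield L)) L (IsCMField.complexConj L) 3
                    (Matrix.of fun i j : Fin 3 => if i.val + j.val + 1 = 3 then (1 : L) else 0),
                  Measure (Subgroup.centralizer ({γ} : Set (UnitaryGroup.arch (↥(maximalRealSubfield L)) L (IsCMField.complexConj L) 3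
                    (Matrix.of fun i j : Fin 3 => if i.val + j.val + 1 = 3 then (1 : L) else 0)))))
                (tH : ∀ γH : UnitaryGroup.arch (↥(maximalRealSubfield L)) L (IsCMField.complexConj L) 2
                      (Matrix.of fun i j : Fin 2 => if i.val + j.val + 1 = 2 then (1 : L) else 0) ×
                    UnitaryGroup.arch (↥(maximalRealSubfield L)) L (IsCMField.complexConj L) 1
                      (Matrix.of fun i j : Fin 1 => if i.val + j.val + 1 = 1 then (1 : L) else 0),
                  Measure (Subgroup.centralizer ({γH} : Set (UnitaryGroup.arch (↥(maximalRealSubfield L)) L (IsCMField.complexConj L) 2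
                      (Matrix.of fun i j : Fin 2 => if i.val + j.val + 1 = 2 then (1 : L) else 0) ×
                    UnitaryGroup.arch (↥(maximalRealSubfield L)) L (IsCMField.complexConj L) 1
                      (Matrix.of fun i j : Fin 1 => if i.val + j.val + 1 = 1 then (1 : L) else 0)))))
            (hherm : (H'.map (cmConjRingHom L)).transpose = H')
            (hCTM : CanonicalTransferMatrix L H' Tinf.Δ νH νG Sbad Δ mH mG)
            (hACS : ArchCanonicalSingularMatrix L H' Tinf νGi νqi νHi hanis m' m mHi t' t tH),
    ∀ (μ : Literature.NumberTheory.GaloisRepresentations.HeckeCharacter L) (hμu : μ.IsUnitary)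
      (hμω : ∀ x : Literature.NumberTheory.GaloisRepresentations.ideleGroup ↥(maximalRealSubfield L),
        μ (AdeleRing.ideleBaseChange (↥(maximalRealSubfield L)) L x) = quadraticHeckeCharCM L x)
      (hΔ : Δ = finExplicitCollection L H' μ (finExplicitDelta_conj_left_all L H' μ) (finExplicitDelta_conj_right_all L H' μ))
      (hTinf : Tinf = archCanonicalTransferFactor L H' μ),
        ∀ (mGs₀ : ∀ v : HeightOneSpectrum (𝓞 ↥(maximalRealSubfield L)), OrbitalMeasureFamily ((UnitaryGroup.cmDatum L 3 H').Local v)),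
          (∀ v, (mGs₀ v).IsQuotientOf (fun x : (UnitaryGroup.cmDatum L 3 H').Local v => ∃ γ₀ : (UnitaryGroup.cmDatum L 3 H').Rational, ¬ IsRegularElt (γ₀.val : GL (Fin 3) L) ∧
                Corresponds (UnitaryGroup.conjLocal L (IsCMField.complexConj L) v)
                  ((UnitaryGroup.adelicForm L 3 H').map (UnitaryGroup.adeleToLocal L v))
                  ((UnitaryGroup.adelicForm L 3 H').map (UnitaryGroup.adeleToLocal L v))
                  ((UnitaryGroup.cmDatum L 3 H').toLocal v ((UnitaryGroup.cmDatum L 3 H').toAdelic γ₀)) x) (νG v) (Literature.NumberTheory.Weil1982.UnitaryFinTopForm.finTamagawaPartner L 3 H' v)) →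
              ∀ (γ₀ : (UnitaryGroup.cmDatum L 3 H').Rational) (e₁ e₂ : L), e₁ ≠ e₂ →
                ((((γ₀ : unitaryGroup (cmConjRingHom L) H').val : GL (Fin 3) L) : Matrix (Fin 3) (Fin 3) L) - e₁ • (1 : Matrix (Fin 3) (Fin 3) L)) * ((((γ₀ : unitaryGroup (cmConjRingHom L) H').val : GL (Fin 3) L) : Matrix (Fin 3) (Fin 3) L) - e₂ • (1 : Matrix (Fin 3) (Fin 3) L)) = 0 →
                (¬ ∃ ζ : L, (((γ₀ : unitaryGroup (cmConjRingHom L) H').val : GL (Fin 3) L) : Matrix (Fin 3) (Fin 3) L) = ζ • (1 : Matrix (Fin 3) (Fin 3) L)) →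
                (((γ₀ : unitaryGroup (cmConjRingHom L) H').val : GL (Fin 3) L) : Matrix (Fin 3) (Fin 3) L).charpoly =
                  (Polynomial.X - Polynomial.C e₁) ^ 2 * (Polynomial.X - Polynomial.C e₂) →
                ∀ (γH : (UnitaryGroup.cmDatum L 2 (Matrix.of fun i j : Fin 2 => if i.val + j.val + 1 = 2 then (1 : L) else 0)).Rational ×
                    (UnitaryGroup.cmDatum L 1 (Matrix.of fun i j : Fin 1 => if i.val + j.val + 1 = 1 then (1 : L) else 0)).Rational),
                  (((γH.1 : unitaryGroup (cmConjRingHom L) (Matrix.of fun i j : Fin 2 => if i.val + j.val + 1 = 2 then (1 : L) else 0)).val : GL (Fin 2) L) : Matrix (Fin 2) (Fin 2) L) =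
                    e₁ • (1 : Matrix (Fin 2) (Fin 2) L) →
                  (((γH.2 : unitaryGroup (cmConjRingHom L) (Matrix.of fun i j : Fin 1 => if i.val + j.val + 1 = 1 then (1 : L) else 0)).val : GL (Fin 1) L) : Matrix (Fin 1) (Fin 1) L) 0 0 = e₂ →
                  ∀ (v : HeightOneSpectrum (𝓞 ↥(maximalRealSubfield L)))
    (fH : (UnitaryGroup.cmDatum L 2 (Matrix.of fun i j : Fin 2 => if i.val + j.val + 1 = 2 then (1 : L) else 0)).Local v × (UnitaryGroup.cmDatum L 1 (Matrix.of fun i j : Fin 1 => if i.val + j.val + 1 = 1 then (1 : L) else 0)).Local v → ℂ) (f : (UnitaryGroup.cmDatum L 3 H').Local v → ℂ),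
                    IsLocSmooth f → IsLocSmooth fH → IsLocalDeltaTransfer L H' v (Δ v) (mH v) (mG v) fH f →
                    localStableOrbitalIntegral L 3 H' v (mGs₀ v) f ((UnitaryGroup.cmDatum L 3 H').toLocal v ((UnitaryGroup.cmDatum L 3 H').toAdelic γ₀)) = 0 →
                    fH ((UnitaryGroup.cmDatum L 2 (Matrix.of fun i j : Fin 2 => if i.val + j.val + 1 = 2 then (1 : L) else 0)).toLocal v ((UnitaryGroup.cmDatum L 2 (Matrix.of fun i j : Fin 2 => if i.val + j.val + 1 = 2 then (1 : L) else 0)).toAdelic γH.1),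
                            (UnitaryGroup.cmDatum L 1 (Matrix.of fun i j : Fin 1 => if i.val + j.val + 1 = 1 then (1 : L) else 0)).toLocal v ((UnitaryGroup.cmDatum L 1 (Matrix.of fun i j : Fin 1 => if i.val + j.val + 1 = 1 then (1 : L) else 0)).toAdelic γH.2)) = 0
)
    (hChargeR :
        ∀ (hK : ∀ v : HeightOneSpectrum (𝓞 ↥(maximalRealSubfield L)), νG v (UnitaryGroup.cmLocalIntegralLevel L 3 H' v : Set ((UnitaryGroup.cmDatum L 3 H').Local v)) = 1)
          (hanis : ∀ x : Fin 3 → L, hermForm (cmConjRingHom L) H' x x = 0 → x = 0)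
          (Sbad : Finset (HeightOneSpectrum (𝓞 ↥(maximalRealSubfield L))))
              (Δ : ∀ v : HeightOneSpectrum (𝓞 ↥(maximalRealSubfield L)), LocalTransferFactor L H' v)
              (mH : ∀ v : HeightOneSpectrum (𝓞 ↥(maximalRealSubfield L)),
                OrbitalMeasureFamily ((UnitaryGroup.cmDatum L 2 (Matrix.of fun i j : Fin 2 => if i.val + j.val + 1 = 2 then (1 : L) else 0)).Local v ×
                  (UnitaryGroup.cmDatum L 1 (Matrix.of fun i j : Fin 1 => if i.val + j.val + 1 = 1 then (1 : L) else 0)).Local v))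
              (mG : ∀ v : HeightOneSpectrum (𝓞 ↥(maximalRealSubfield L)), OrbitalMeasureFamily ((UnitaryGroup.cmDatum L 3 H').Local v))
          (m' : OrbitalMeasureFamily (UnitaryGroup.arch (↥(maximalRealSubfield L)) L (IsCMField.complexConj L) 3 H'))
                (m : OrbitalMeasureFamily (UnitaryGroup.arch (↥(maximalRealSubfield L)) L (IsCMField.complexConj L) 3
                  (Matrix.of fun i j : Fin 3 => if i.val + j.val + 1 = 3 then (1 : L) else 0)))
                (mHi : OrbitalMeasureFamily (UnitaryGroup.arch (↥(maximalRealSubfield L)) L (IsCMField.complexConj L) 2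
                    (Matrix.of fun i j : Fin 2 => if i.val + j.val + 1 = 2 then (1 : L) else 0) ×
                  UnitaryGroup.arch (↥(maximalRealSubfield L)) L (IsCMField.complexConj L) 1
                    (Matrix.of fun i j : Fin 1 => if i.val + j.val + 1 = 1 then (1 : L) else 0)))
                (t' : ∀ γ' : UnitaryGroup.arch (↥(maximalRealSubfield L)) L (IsCMField.complexConj L) 3 H',
                  Measure (Subgroup.centralizer ({γ'} : Set (UnitaryGroup.arch (↥(maximalRealSubfield L)) L (IsCMField.complexConj L) 3 H'))))
                (t : ∀ γ : UnitaryGroup.arch (↥(maximalRealSubfield L)) L (IsCMField.complexConj L) 3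
                    (Matrix.of fun i j : Fin 3 => if i.val + j.val + 1 = 3 then (1 : L) else 0),
                  Measure (Subgroup.centralizer ({γ} : Set (UnitaryGroup.arch (↥(maximalRealSubfield L)) L (IsCMField.complexConj L) 3
                    (Matrix.of fun i j : Fin 3 => if i.val + j.val + 1 = 3 then (1 : L) else 0)))))
                (tH : ∀ γH : UnitaryGroup.arch (↥(maximalRealSubfield L)) L (IsCMField.complexConj L) 2
                      (Matrix.of fun i j : Fin 2 => if i.val + j.val + 1 = 2 then (1 : L) else 0) ×
                    UnitaryGroup.arch (↥(maximalRealSubfield L)) L (IsCMField.complexConj L) 1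
                      (Matrix.of fun i j : Fin 1 => if i.val + j.val + 1 = 1 then (1 : L) else 0),
                  Measure (Subgroup.centralizer ({γH} : Set (UnitaryGroup.arch (↥(maximalRealSubfield L)) L (IsCMField.complexConj L) 2
                      (Matrix.of fun i j : Fin 2 => if i.val + j.val + 1 = 2 then (1 : L) else 0) ×
                    UnitaryGroup.arch (↥(maximalRealSubfield L)) L (IsCMField.complexConj L) 1
                      (Matrix.of fun i j : Fin 1 => if i.val + j.val + 1 = 1 then (1 : L) else 0)))))
            (hherm : (H'.map (cmConjRingHom L)).transpose = H')
            (hCTM : CanonicalTransferMatrix L H' Tinf.Δ νH νG Sbad Δ mH mG)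
            (hACS : ArchCanonicalSingularMatrix L H' Tinf νGi νqi νHi hanis m' m mHi t' t tH),
    ∀ (μ : Literature.NumberTheory.GaloisRepresentations.HeckeCharacter L) (hμu : μ.IsUnitary)
      (hμω : ∀ x : Literature.NumberTheory.GaloisRepresentations.ideleGroup ↥(maximalRealSubfield L),
        μ (AdeleRing.ideleBaseChange (↥(maximalRealSubfield L)) L x) = quadraticHeckeCharCM L x)
      (hΔ : Δ = finExplicitCollection L H' μ (finExplicitDelta_conj_left_all L H' μ) (finExplicitDelta_conj_right_all L H' μ))
      (hTinf : Tinf = archCanonicalTransferFactor L H' μ),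
              ∀ (γ₀ : (UnitaryGroup.cmDatum L 3 H').Rational) (e₁ e₂ : L), e₁ ≠ e₂ →
                ((((γ₀ : unitaryGroup (cmConjRingHom L) H').val : GL (Fin 3) L) : Matrix (Fin 3) (Fin 3) L) - e₁ • (1 : Matrix (Fin 3) (Fin 3) L)) * ((((γ₀ : unitaryGroup (cmConjRingHom L) H').val : GL (Fin 3) L) : Matrix (Fin 3) (Fin 3) L) - e₂ • (1 : Matrix (Fin 3) (Fin 3) L)) = 0 →
                (¬ ∃ ζ : L, (((γ₀ : unitaryGroup (cmConjRingHom L) H').val : GL (Fin 3) L) : Matrix (Fin 3) (Fin 3) L) = ζ • (1 : Matrix (Fin 3) (Fin 3) L)) →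
                (((γ₀ : unitaryGroup (cmConjRingHom L) H').val : GL (Fin 3) L) : Matrix (Fin 3) (Fin 3) L).charpoly =
                  (Polynomial.X - Polynomial.C e₁) ^ 2 * (Polynomial.X - Polynomial.C e₂) →
                ∀ (γH : (UnitaryGroup.cmDatum L 2 (Matrix.of fun i j : Fin 2 => if i.val + j.val + 1 = 2 then (1 : L) else 0)).Rational ×
                    (UnitaryGroup.cmDatum L 1 (Matrix.of fun i j : Fin 1 => if i.val + j.val + 1 = 1 then (1 : L) else 0)).Rational),
                  (((γH.1 : unitaryGroup (cmConjRingHom L) (Matrix.of fun i j : Fin 2 => if i.val + j.val + 1 = 2 then (1 : L) else 0)).val : GL (Fin 2) L) : Matrix (Fin 2) (Fin 2) L) =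
                    e₁ • (1 : Matrix (Fin 2) (Fin 2) L) →
                  (((γH.2 : unitaryGroup (cmConjRingHom L) (Matrix.of fun i j : Fin 1 => if i.val + j.val + 1 = 1 then (1 : L) else 0)).val : GL (Fin 1) L) : Matrix (Fin 1) (Fin 1) L) 0 0 = e₂ →
                  ∀ (v : HeightOneSpectrum (𝓞 ↥(maximalRealSubfield L))), ∃ (fH : (UnitaryGroup.cmDatum L 2 (Matrix.of fun i j : Fin 2 => if i.val + j.val + 1 = 2 then (1 : L) else 0)).Local v × (UnitaryGroup.cmDatum L 1 (Matrix.of fun i j : Fin 1 => if i.val + j.val + 1 = 1 then (1 : L) else 0)).Local v → ℂ) (f : (UnitaryGroup.cmDatum L 3 H').Local v → ℂ),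
                    IsLocSmooth f ∧ IsLocSmooth fH ∧ IsLocalDeltaTransfer L H' v (Δ v) (mH v) (mG v) fH f ∧ fH ((UnitaryGroup.cmDatum L 2 (Matrix.of fun i j : Fin 2 => if i.val + j.val + 1 = 2 then (1 : L) else 0)).toLocal v ((UnitaryGroup.cmDatum L 2 (Matrix.of fun i j : Fin 2 => if i.val + j.val + 1 = 2 then (1 : L) else 0)).toAdelic γH.1),
                            (UnitaryGroup.cmDatum L 1 (Matrix.of fun i j : Fin 1 => if i.val + j.val + 1 = 1 then (1 : L) else 0)).toLocal v ((UnitaryGroup.cmDatum L 1 (Matrix.of fun i j : Fin 1 => if i.val + j.val + 1 = 1 then (1 : L) else 0)).toAdelic γH.2)) ≠ 0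
) :
        ∀ (hK : ∀ v : HeightOneSpectrum (𝓞 ↥(maximalRealSubfield L)), νG v (UnitaryGroup.cmLocalIntegralLevel L 3 H' v : Set ((UnitaryGroup.cmDatum L 3 H').Local v)) = 1)
          (hanis : ∀ x : Fin 3 → L, hermForm (cmConjRingHom L) H' x x = 0 → x = 0)
          (Sbad : Finset (HeightOneSpectrum (𝓞 ↥(maximalRealSubfield L))))
              (Δ : ∀ v : HeightOneSpectrum (𝓞 ↥(maximalRealSubfield L)), LocalTransferFactor L H' v)
              (mH : ∀ v : HeightOneSpectrum (𝓞 ↥(maximalRealSubfield L)),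
                OrbitalMeasureFamily ((UnitaryGroup.cmDatum L 2 (Matrix.of fun i j : Fin 2 => if i.val + j.val + 1 = 2 then (1 : L) else 0)).Local v ×
                  (UnitaryGroup.cmDatum L 1 (Matrix.of fun i j : Fin 1 => if i.val + j.val + 1 = 1 then (1 : L) else 0)).Local v))
              (mG : ∀ v : HeightOneSpectrum (𝓞 ↥(maximalRealSubfield L)), OrbitalMeasureFamily ((UnitaryGroup.cmDatum L 3 H').Local v))
          (m' : OrbitalMeasureFamily (UnitaryGroup.arch (↥(maximalRealSubfield L)) L (IsCMField.complexConj L) 3 H'))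
                (m : OrbitalMeasureFamily (UnitaryGroup.arch (↥(maximalRealSubfield L)) L (IsCMField.complexConj L) 3
                  (Matrix.of fun i j : Fin 3 => if i.val + j.val + 1 = 3 then (1 : L) else 0)))
                (mHi : OrbitalMeasureFamily (UnitaryGroup.arch (↥(maximalRealSubfield L)) L (IsCMField.complexConj L) 2
                    (Matrix.of fun i j : Fin 2 => if i.val + j.val + 1 = 2 then (1 : L) else 0) ×
                  UnitaryGroup.arch (↥(maximalRealSubfield L)) L (IsCMField.complexConj L) 1
                    (Matrix.of fun i j : Fin 1 => if i.val + j.val + 1 = 1 then (1 : L) else 0)))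
                (t' : ∀ γ' : UnitaryGroup.arch (↥(maximalRealSubfield L)) L (IsCMField.complexConj L) 3 H',
                  Measure (Subgroup.centralizer ({γ'} : Set (UnitaryGroup.arch (↥(maximalRealSubfield L)) L (IsCMField.complexConj L) 3 H'))))
                (t : ∀ γ : UnitaryGroup.arch (↥(maximalRealSubfield L)) L (IsCMField.complexConj L) 3
                    (Matrix.of fun i j : Fin 3 => if i.val + j.val + 1 = 3 then (1 : L) else 0),
                  Measure (Subgroup.centralizer ({γ} : Set (UnitaryGroup.arch (↥(maximalRealSubfield L)) L (IsCMField.complexConj L) 3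
                    (Matrix.of fun i j : Fin 3 => if i.val + j.val + 1 = 3 then (1 : L) else 0)))))
                (tH : ∀ γH : UnitaryGroup.arch (↥(maximalRealSubfield L)) L (IsCMField.complexConj L) 2
                      (Matrix.of fun i j : Fin 2 => if i.val + j.val + 1 = 2 then (1 : L) else 0) ×
                    UnitaryGroup.arch (↥(maximalRealSubfield L)) L (IsCMField.complexConj L) 1
                      (Matrix.of fun i j : Fin 1 => if i.val + j.val + 1 = 1 then (1 : L) else 0),
                  Measure (Subgroup.centralizer ({γH} : Set (UnitaryGroup.arch (↥(maximalRealSubfield L)) L (IsCMField.complexConj L) 2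
                      (Matrix.of fun i j : Fin 2 => if i.val + j.val + 1 = 2 then (1 : L) else 0) ×
                    UnitaryGroup.arch (↥(maximalRealSubfield L)) L (IsCMField.complexConj L) 1
                      (Matrix.of fun i j : Fin 1 => if i.val + j.val + 1 = 1 then (1 : L) else 0)))))
            (hherm : (H'.map (cmConjRingHom L)).transpose = H')
            (hCTM : CanonicalTransferMatrix L H' Tinf.Δ νH νG Sbad Δ mH mG)
            (hACS : ArchCanonicalSingularMatrix L H' Tinf νGi νqi νHi hanis m' m mHi t' t tH),
    ∀ (μ : Literature.NumberTheory.GaloisRepresentations.HeckeCharacter L) (hμu : μ.IsUnitary)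
      (hμω : ∀ x : Literature.NumberTheory.GaloisRepresentations.ideleGroup ↥(maximalRealSubfield L),
        μ (AdeleRing.ideleBaseChange (↥(maximalRealSubfield L)) L x) = quadraticHeckeCharCM L x)
      (hΔ : Δ = finExplicitCollection L H' μ (finExplicitDelta_conj_left_all L H' μ) (finExplicitDelta_conj_right_all L H' μ))
      (hTinf : Tinf = archCanonicalTransferFactor L H' μ),
        ∀ (mGs₀ : ∀ v : HeightOneSpectrum (𝓞 ↥(maximalRealSubfield L)), OrbitalMeasureFamily ((UnitaryGroup.cmDatum L 3 H').Local v)),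
          (∀ v, (mGs₀ v).IsQuotientOf (fun x : (UnitaryGroup.cmDatum L 3 H').Local v => ∃ γ₀ : (UnitaryGroup.cmDatum L 3 H').Rational, ¬ IsRegularElt (γ₀.val : GL (Fin 3) L) ∧
                Corresponds (UnitaryGroup.conjLocal L (IsCMField.complexConj L) v)
                  ((UnitaryGroup.adelicForm L 3 H').map (UnitaryGroup.adeleToLocal L v))
                  ((UnitaryGroup.adelicForm L 3 H').map (UnitaryGroup.adeleToLocal L v))
                  ((UnitaryGroup.cmDatum L 3 H').toLocal v ((UnitaryGroup.cmDatum L 3 H').toAdelic γ₀)) x) (νG v) (Literature.NumberTheory.Weil1982.UnitaryFinTopForm.finTamagawaPartner L 3 H' v)) →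
              ∀ (γ₀ : (UnitaryGroup.cmDatum L 3 H').Rational) (e₁ e₂ : L), e₁ ≠ e₂ →
                ((((γ₀ : unitaryGroup (cmConjRingHom L) H').val : GL (Fin 3) L) : Matrix (Fin 3) (Fin 3) L) - e₁ • (1 : Matrix (Fin 3) (Fin 3) L)) * ((((γ₀ : unitaryGroup (cmConjRingHom L) H').val : GL (Fin 3) L) : Matrix (Fin 3) (Fin 3) L) - e₂ • (1 : Matrix (Fin 3) (Fin 3) L)) = 0 →
                (¬ ∃ ζ : L, (((γ₀ : unitaryGroup (cmConjRingHom L) H').val : GL (Fin 3) L) : Matrix (Fin 3) (Fin 3) L) = ζ • (1 : Matrix (Fin 3) (Fin 3) L)) →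
                (((γ₀ : unitaryGroup (cmConjRingHom L) H').val : GL (Fin 3) L) : Matrix (Fin 3) (Fin 3) L).charpoly =
                  (Polynomial.X - Polynomial.C e₁) ^ 2 * (Polynomial.X - Polynomial.C e₂) →
                ∀ (γH : (UnitaryGroup.cmDatum L 2 (Matrix.of fun i j : Fin 2 => if i.val + j.val + 1 = 2 then (1 : L) else 0)).Rational ×
                    (UnitaryGroup.cmDatum L 1 (Matrix.of fun i j : Fin 1 => if i.val + j.val + 1 = 1 then (1 : L) else 0)).Rational),
                  (((γH.1 : unitaryGroup (cmConjRingHom L) (Matrix.of fun i j : Fin 2 => if i.val + j.val + 1 = 2 then (1 : L) else 0)).val : GL (Fin 2) L) : Matrix (Fin 2) (Fin 2) L) =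
                    e₁ • (1 : Matrix (Fin 2) (Fin 2) L) →
                  (((γH.2 : unitaryGroup (cmConjRingHom L) (Matrix.of fun i j : Fin 1 => if i.val + j.val + 1 = 1 then (1 : L) else 0)).val : GL (Fin 1) L) : Matrix (Fin 1) (Fin 1) L) 0 0 = e₂ →
                  ∀ (v : HeightOneSpectrum (𝓞 ↥(maximalRealSubfield L))), Subsingleton (UnitaryGroup.PlacesOver L v) →
                    ∃ cv : ℂ, cv ≠ 0 ∧ ∀
                          (fH : (UnitaryGroup.cmDatum L 2 (Matrix.of fun i j : Fin 2 => if i.val + j.val + 1 = 2 then (1 : L) else 0)).Local v × (UnitaryGroup.cmDatum L 1 (Matrix.of fun i j : Fin 1 => if i.val + j.val + 1 = 1 then (1 : L) else 0)).Local v → ℂ) (f : (UnitaryGroup.cmDatum L 3 H').Local v → ℂ),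
                        IsLocSmooth f → IsLocSmooth fH → IsLocalDeltaTransfer L H' v (Δ v) (mH v) (mG v) fH f →
                        localStableOrbitalIntegral L 3 H' v (mGs₀ v) f ((UnitaryGroup.cmDatum L 3 H').toLocal v ((UnitaryGroup.cmDatum L 3 H').toAdelic γ₀)) =
                          cv * fH ((UnitaryGroup.cmDatum L 2 (Matrix.of fun i j : Fin 2 => if i.val + j.val + 1 = 2 then (1 : L) else 0)).toLocal v ((UnitaryGroup.cmDatum L 2 (Matrix.of fun i j : Fin 2 => if i.val + j.val + 1 = 2 then (1 : L) else 0)).toAdelic γH.1),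
                            (UnitaryGroup.cmDatum L 1 (Matrix.of fun i j : Fin 1 => if i.val + j.val + 1 = 1 then (1 : L) else 0)).toLocal v ((UnitaryGroup.cmDatum L 1 (Matrix.of fun i j : Fin 1 => if i.val + j.val + 1 = 1 then (1 : L) else 0)).toAdelic γH.2))
 := by
  intro hK hanis Sbad Δ mH mG m' m mHi t' t tH hherm hCTM hACS μ hμu hμω hΔ hTinf mGs₀ hQ γ₀ e₁ e₂ hne hprod hnc hchar γH hγH₁ hγH₂ v _
  -- the two LIVE U3 sockets, read at these data (#7R takes the pinned binders `μ … hTinf` that #3 itself carries)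
  have hKer' := hKer hK hanis Sbad Δ mH mG m' m mHi t' t tH hherm hCTM hACS μ hμu hμω hΔ hTinf mGs₀ hQ γ₀ e₁ e₂ hne hprod hnc hchar γH hγH₁ hγH₂ v
  have hCharge' := hChargeR hK hanis Sbad Δ mH mG m' m mHi t' t tH hherm hCTM hACS μ hμu hμω hΔ hTinf γ₀ e₁ e₂ hne hprod hnc hchar γH hγH₁ hγH₂ v
  clear hKer hChargeR
  -- The letters' uniform frame carries adelic-side structure that this finite-place statement never reads; the frozen socket signature includes it
  -- (automatically included instance binders), so it is acknowledged here — keeping `type_of%` identity with the sockets — not omitted.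
  have _ := hCcl
  have _ := ‹BorelSpace (UnitaryGroup.cmDatum L 3 H').Adelic›
  have _ := ‹∀ g : (UnitaryGroup.cmDatum L 3 H').Adelic,
    BorelSpace ((UnitaryGroup.cmDatum L 3 H').Adelic ⧸ Subgroup.centralizer ({g} : Set (UnitaryGroup.cmDatum L 3 H').Adelic))›
  have _ := ‹∀ γ : (UnitaryGroup.cmDatum L 3 H').Adelic, BorelSpace (↥(Subgroup.centralizer ({γ} : Set (UnitaryGroup.cmDatum L 3 H').Adelic)) ⧸
    ((UnitaryGroup.cmDatum L 3 H').quotientSubgroup ⊓ Subgroup.centralizer ({γ} : Set (UnitaryGroup.cmDatum L 3 H').Adelic)).subgroupOf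
      (Subgroup.centralizer ({γ} : Set (UnitaryGroup.cmDatum L 3 H').Adelic)))›
  have _ := ‹∀ γ : (UnitaryGroup.cmDatum L 3 H').Adelic, (count : Measure ↥(((UnitaryGroup.cmDatum L 3 H').quotientSubgroup ⊓
    Subgroup.centralizer ({γ} : Set (UnitaryGroup.cmDatum L 3 H').Adelic)).subgroupOf (Subgroup.centralizer ({γ} : Set (UnitaryGroup.cmDatum L 3 H').Adelic)))).IsHaarMeasure›
  -- the frame's side conditions at `v`
  have hnreg : ¬ IsRegularElt (γ₀.val : GL (Fin 3) L) := not_isRegularElt_of_charpoly _ e₁ e₂ hchar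
  have hfin : ∀ c : ConjClasses ((UnitaryGroup.cmDatum L 3 H').Local v),
      IsStablyConj (UnitaryGroup.conjLocal L (IsCMField.complexConj L) v) ((UnitaryGroup.adelicForm L 3 H').map (UnitaryGroup.adeleToLocal L v))
        ((UnitaryGroup.cmDatum L 3 H').toLocal v ((UnitaryGroup.cmDatum L 3 H').toAdelic γ₀)) (Quotient.out c) → IsFiniteMeasureOnCompacts (mGs₀ v c) := by
    intro c hc
    obtain ⟨_, _, hm⟩ := (OrbitalMeasureFamily.isQuotientOf_iff _ _ _ _).1 (hQ v) c ⟨γ₀, hnreg, hc⟩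
    rw [hm]
    infer_instance
  exact K2E4SingularTransferKernelCore.singularTransfer_of_kernel_of_charge L H' v hherm (det_ne_zero_of_anisotropic hanis)
    (hCTM.1 v).1.2.1 (hCTM.1 v).1.2.2.1 _ (isUnit_algebraMap_localRing_sub v hne) (mul_sub_smul_toLocal_toAdelic_eq_zero v γ₀ hprod) hfin _
    hKer' hCharge'

end Frame

end Summit.HodgeConjecture.HodgeConjecture.Cruxes.H413.K2E4ExplicitNonsplitSingularTransferR

end
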